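import Literature.MathematicalPhysics.QuantumFieldTheory.ConformalBootstrap3D.DiagonalRatioLemma
import Mathlib.Algebra.Order.BigOperators.Group.Finset
import Mathlib.Topology.Algebra.InfiniteSum.NatInt
import Mathlib.Tactic.Ring
import Mathlib.Tactic.Linarith
import HarnessLib

/-!
# Two-sided enclosure of a non-negative-coefficient series from a partial sum and the ratio lemma

For `g(y) = Σ_{n ≥ 0} a_n y^{Δ+n}` with `a_n ≥ 0` and `0 < y ≤ y'` (the diagonal of a conformal block
for identical external scalars; `DiagonalRatioLemma.lean`, `ZSeriesBlockCoefficients.lean`):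

* the partial sum `S_N(y) = Σ_{n ≤ N} a_n y^{Δ+n}` is a LOWER bound, `S_N(y) ≤ g(y)`
  (`partialSum_le_tsum_rpow`);
* `g(y) = S_N(y) + T_N(y)` with the tail `T_N(y) = Σ_{n ≥ 0} a_{n+N+1} y^{Δ+n+N+1}`
  (`tsum_rpow_eq_partialSum_add_tail`);
* the tail obeys the ratio lemma with exponent `Δ + N + 1`:
  `T_N(y) ≤ (y/y')^{Δ+N+1} T_N(y')` (`tail_rpow_ratio_le`);
* hence the UPPER bound `g(y) ≤ S_N(y) + (y/y')^{Δ+N+1} (g(y') - S_N(y'))`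
  (`tsum_rpow_le_partialSum_add_ratio_tail`), where `g(y')` may be replaced by any upper bound
  for it (`tsum_rpow_le_partialSum_add_ratio_bound`).

This is the shape of the per-cell block enclosure in the diagonal point-functional architecture
(pub-ising3d REFEREE F26, "implementation 2": partial sums are rigorous lower bounds by positivity,
the ratio lemma bounds the tail from an upper bound at a larger point). Elementary; no conformal
input. [folklore]
-/

namespace Literature.MathematicalPhysics.QuantumFieldTheory.ConformalBootstrap3D

open Finset

/-- The partial sum is a lower bound for a convergent series with non-negative terms
`a_n y^{Δ+n}`, `a_n ≥ 0`, `y ≥ 0`. [folklore] -/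
theorem partialSum_le_tsum_rpow {a : ℕ → ℝ} {y Δ : ℝ} (ha : ∀ n, 0 ≤ a n) (hy : 0 ≤ y)
    (hs : Summable fun n => a n * y ^ (Δ + n)) (N : ℕ) :
    ∑ n ∈ range (N + 1), a n * y ^ (Δ + n) ≤ ∑' n, a n * y ^ (Δ + n) :=
  hs.sum_le_tsum (range (N + 1)) fun n _ => mul_rpow_add_nonneg (ha n) hy n

/-- Exponent bookkeeping for the shifted tail: `Δ + (n + (N+1)) = (Δ + N + 1) + n` inside `rpow`.
[folklore] -/
theorem rpow_add_shift (y Δ : ℝ) (n N : ℕ) :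
    y ^ (Δ + ((n + (N + 1) : ℕ) : ℝ)) = y ^ ((Δ + N + 1) + (n : ℝ)) := by
  congr 1
  push_cast
  ring

/-- Splitting off the tail after `N + 1` terms:
`Σ_n a_n y^{Δ+n} = Σ_{n ≤ N} a_n y^{Δ+n} + Σ_n a_{n+N+1} y^{(Δ+N+1)+n}`. [folklore] -/
theorem tsum_rpow_eq_partialSum_add_tail {a : ℕ → ℝ} {y Δ : ℝ}
    (hs : Summable fun n => a n * y ^ (Δ + n)) (N : ℕ) :
    ∑' n, a n * y ^ (Δ + n) =
      ∑ n ∈ range (N + 1), a n * y ^ (Δ + n) +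
        ∑' n, a (n + (N + 1)) * y ^ ((Δ + N + 1) + (n : ℝ)) := by
  have h := hs.sum_add_tsum_nat_add (N + 1)
  rw [← h]
  congr 1
  refine tsum_congr fun n => ?_
  rw [rpow_add_shift]

/-- Summability of the shifted tail series (in the re-based exponent form). [folklore] -/
theorem summable_tail_rpow {a : ℕ → ℝ} {y Δ : ℝ}
    (hs : Summable fun n => a n * y ^ (Δ + n)) (N : ℕ) :
    Summable fun n => a (n + (N + 1)) * y ^ ((Δ + N + 1) + (n : ℝ)) := by
  have h := (summable_nat_add_iff (N + 1)).mpr hs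
  refine h.congr fun n => ?_
  show a (n + (N + 1)) * y ^ (Δ + ((n + (N + 1) : ℕ) : ℝ)) = _
  rw [rpow_add_shift]

/-- **Ratio lemma for the tail.** For `a_n ≥ 0`, `0 < y ≤ y'` and the series convergent at `y'`:
`Σ_n a_{n+N+1} y^{(Δ+N+1)+n} ≤ (y/y')^{Δ+N+1} Σ_n a_{n+N+1} y'^{(Δ+N+1)+n}`. [folklore] -/
theorem tail_rpow_ratio_le {a : ℕ → ℝ} {y y' Δ : ℝ} (ha : ∀ n, 0 ≤ a n) (hy : 0 < y)
    (hyy' : y ≤ y') (hs' : Summable fun n => a n * y' ^ (Δ + n)) (N : ℕ) :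
    ∑' n, a (n + (N + 1)) * y ^ ((Δ + N + 1) + (n : ℝ)) ≤
      (y / y') ^ (Δ + N + 1) * ∑' n, a (n + (N + 1)) * y' ^ ((Δ + N + 1) + (n : ℝ)) :=
  tsum_rpow_ratio_le (a := fun n => a (n + (N + 1))) (fun _ => ha _) hy hyy'
    (summable_tail_rpow hs' N)

/-- **Upper enclosure.** For `a_n ≥ 0`, `0 < y ≤ y'`, series convergent at `y'`:
`g(y) ≤ S_N(y) + (y/y')^{Δ+N+1} · (g(y') - S_N(y'))`, where `g` is the full series and `S_N` the
partial sum through `n = N`. [folklore] -/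
theorem tsum_rpow_le_partialSum_add_ratio_tail {a : ℕ → ℝ} {y y' Δ : ℝ} (ha : ∀ n, 0 ≤ a n)
    (hy : 0 < y) (hyy' : y ≤ y') (hs' : Summable fun n => a n * y' ^ (Δ + n)) (N : ℕ) :
    ∑' n, a n * y ^ (Δ + n) ≤
      ∑ n ∈ range (N + 1), a n * y ^ (Δ + n) +
        (y / y') ^ (Δ + N + 1) *
          (∑' n, a n * y' ^ (Δ + n) - ∑ n ∈ range (N + 1), a n * y' ^ (Δ + n)) := by
  have hs : Summable fun n => a n * y ^ (Δ + n) := summable_rpow_of_le ha hy hyy' hs'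
  have htail' : ∑' n, a n * y' ^ (Δ + n) - ∑ n ∈ range (N + 1), a n * y' ^ (Δ + n) =
      ∑' n, a (n + (N + 1)) * y' ^ ((Δ + N + 1) + (n : ℝ)) := by
    rw [tsum_rpow_eq_partialSum_add_tail hs' N]
    ring
  rw [htail', tsum_rpow_eq_partialSum_add_tail hs N]
  have := tail_rpow_ratio_le ha hy hyy' hs' N
  linarith

/-- **Upper enclosure from an upper bound at the larger point.** If moreover `g(y') ≤ U` (e.g. a
certified upper bound from a closed form at `y'`), then
`g(y) ≤ S_N(y) + (y/y')^{Δ+N+1} · (U - S_N(y'))`. [folklore] -/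
theorem tsum_rpow_le_partialSum_add_ratio_bound {a : ℕ → ℝ} {y y' Δ U : ℝ} (ha : ∀ n, 0 ≤ a n)
    (hy : 0 < y) (hyy' : y ≤ y') (hs' : Summable fun n => a n * y' ^ (Δ + n)) (N : ℕ)
    (hU : ∑' n, a n * y' ^ (Δ + n) ≤ U) :
    ∑' n, a n * y ^ (Δ + n) ≤
      ∑ n ∈ range (N + 1), a n * y ^ (Δ + n) +
        (y / y') ^ (Δ + N + 1) * (U - ∑ n ∈ range (N + 1), a n * y' ^ (Δ + n)) := by
  have h1 := tsum_rpow_le_partialSum_add_ratio_tail ha hy hyy' hs' N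
  have hy' : 0 < y' := lt_of_lt_of_le hy hyy'
  have hfac : 0 ≤ (y / y') ^ (Δ + N + 1) := Real.rpow_nonneg (div_nonneg hy.le hy'.le) _
  have h2 : (y / y') ^ (Δ + N + 1) *
        (∑' n, a n * y' ^ (Δ + n) - ∑ n ∈ range (N + 1), a n * y' ^ (Δ + n)) ≤
      (y / y') ^ (Δ + N + 1) * (U - ∑ n ∈ range (N + 1), a n * y' ^ (Δ + n)) :=
    mul_le_mul_of_nonneg_left (by linarith) hfac
  linarith

/-- **Two-sided cell enclosure, packaged.** Under the same hypotheses, with `L := S_N(y)` and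
`R := S_N(y) + (y/y')^{Δ+N+1}(U - S_N(y'))`: `L ≤ g(y) ≤ R`. [folklore] -/
theorem tsum_rpow_mem_Icc {a : ℕ → ℝ} {y y' Δ U : ℝ} (ha : ∀ n, 0 ≤ a n) (hy : 0 < y)
    (hyy' : y ≤ y') (hs' : Summable fun n => a n * y' ^ (Δ + n)) (N : ℕ)
    (hU : ∑' n, a n * y' ^ (Δ + n) ≤ U) :
    ∑' n, a n * y ^ (Δ + n) ∈
      Set.Icc (∑ n ∈ range (N + 1), a n * y ^ (Δ + n))
        (∑ n ∈ range (N + 1), a n * y ^ (Δ + n) +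
          (y / y') ^ (Δ + N + 1) * (U - ∑ n ∈ range (N + 1), a n * y' ^ (Δ + n))) :=
  ⟨partialSum_le_tsum_rpow ha hy.le (summable_rpow_of_le ha hy hyy' hs') N,
    tsum_rpow_le_partialSum_add_ratio_bound ha hy hyy' hs' N hU⟩

end Literature.MathematicalPhysics.QuantumFieldTheory.ConformalBootstrap3D
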